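import Mathlib.Combinatorics.SetFamily.FourFunctions
import Mathlib.Data.Real.Basic
import Mathlib.Data.Fintype.Pi
import Mathlib.Data.Fintype.BigOperators
import Mathlib.Algebra.Order.BigOperators.Ring.Finset
import Mathlib.Tactic.Positivity
import Mathlib.Tactic.FieldSimp
import Mathlib.Tactic.Ring
import HarnessLib

/-!
# PPSZ III: placements — the conditioned product space, Harris' inequality, coordinate independence

Topic `Literature/Computability/FineGrained`, third file of the line `PPSZ*` (Paturi–Pudlák–
Saks–Zane 2005, §3.3 and §4.2). PPSZ analyse the random permutation `π` through *placements*: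
independent uniform reals `α(x) ∈ (0,1)`, ranking the variables by `α`; for general `k`-SAT
(§4.2) the placements are conditioned on the box `Γ = {α : α(x) ≤ θ for all defining x}`. The
algorithm formalised in this line samples *discrete* placements from its coin string, so we work
directly in the finite conditioned product space

* `PPSZ.PSpace Dset K t = Π_w Fin (size w)`, `size w = t` for defining variables `w ∈ Dset` and
  `= K` otherwise (the box `Γ(Dset, t/K)` with the uniform = conditional distribution), with
  `PPSZ.prob E = #{α | E α} / #PSpace` (a real number);
* `PPSZ.prob_and_ge_mul` — **Harris' inequality** (Harris 1960; the special case of FKG used in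
  the proof of PPSZ Lemma 7): two events that are down-sets in the coordinatewise order are
  positively correlated; `PPSZ.prob_forall_ge_prod` — its iteration over a finite family;
  obtained from Mathlib's four-functions/FKG theorem `fkg` on the distributive lattice
  `(PSpace)ᵒᵈ` with the constant weight;
* `PPSZ.prob_coord_and`, `PPSZ.prob_lt_or_eq` — **independence of one coordinate from an event
  not depending on it** (the step `Prob[K_i] = q_i + (1 - q_i) Q_{T_i}(r)` in the proof of
  Lemma 7): `prob (α w < a ∨ E) = q + (1 - q) · prob E` with `q = min(a, size w)/size w`.

Design: probabilities are plain normalised counts in `ℝ`; events are predicates, counted with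
classical decidability. Nothing here mentions formulas: the file is reusable finite probability
on a product of finite chains.

## References

* R. Paturi, P. Pudlák, M. E. Saks, F. Zane, J. ACM 52(3) (2005) 337–364, §3.3 (placements;
  proof of Lemma 7 via Harris' inequality), §4.2 (the conditioning `Γ(D, θ)`).
  [key `PaturiPudlakSaksZane2005`]
* T. E. Harris, *A lower bound for the critical probability in a certain percolation process*,
  Proc. Cambridge Philos. Soc. 56 (1960) 13–20 (Harris' inequality); N. Alon, J. Spencer,
  *The Probabilistic Method*, Ch. 6, Thm. 6.3.2 (Kleitman / FKG). Formal source: Mathlib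
  `Mathlib/Combinatorics/SetFamily/FourFunctions.lean` (`fkg`).
-/

namespace Literature.Computability.FineGrained.PPSZ

open Finset

variable {V : Type*} [DecidableEq V]

/-! ### The conditioned placement space -/

/-- Range size of the placement of `w`: `t` for a defining variable, `K` otherwise.
[cite: PaturiPudlakSaksZane2005, §4.2 (Γ(D, θ): α(v) ≤ θ for v ∈ D)] -/
def size (Dset : Finset V) (K t : ℕ) (w : V) : ℕ := if w ∈ Dset then t else K

/-- `0 < size w` as soon as `0 < K` and `0 < t`. [folklore] -/
theorem size_pos (Dset : Finset V) {K t : ℕ} (hK : 0 < K) (ht : 0 < t) (w : V) :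
    0 < size Dset K t w := by
  unfold size; split_ifs <;> assumption

/-- **The conditioned placement space** `Ω_Γ = Π_w {0, …, size w - 1}`: discrete placements with
the defining variables confined to `{0, …, t-1}` — the box `Γ(Dset, t/K)` of PPSZ §4.2 carrying
its conditional (= uniform) distribution. [cite: PaturiPudlakSaksZane2005, §3.3 (placements) and §4.2 (Γ)] -/
abbrev PSpace (Dset : Finset V) (K t : ℕ) : Type _ := (w : V) → Fin (size Dset K t w)

variable {Dset : Finset V} {K t : ℕ}

/-! ### Down-sets and events ignoring a coordinate -/

/-- An event is a *down-set* if placing variables earlier keeps it (PPSZ phrase it for the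
complementary up-sets `W_i`). [cite: PaturiPudlakSaksZane2005, §3.3 (proof of Lemma 7, (ii))] -/
def IsDown (E : PSpace Dset K t → Prop) : Prop := ∀ ⦃α β : PSpace Dset K t⦄, α ≤ β → E β → E α

/-- The conjunction of down-sets is a down-set. [folklore] -/
theorem IsDown.and {E F : PSpace Dset K t → Prop} (hE : IsDown E) (hF : IsDown F) :
    IsDown fun α => E α ∧ F α := fun _ _ h hβ => ⟨hE h hβ.1, hF h hβ.2⟩

/-- A finite conjunction of down-sets is a down-set. [folklore] -/
theorem IsDown.forall {ι : Type*} (s : Finset ι) {E : ι → PSpace Dset K t → Prop}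
    (hE : ∀ i ∈ s, IsDown (E i)) : IsDown fun α => ∀ i ∈ s, E i α :=
  fun _ _ h hβ i hi => hE i hi h (hβ i hi)

/-- "`w` is placed before `a`" is a down-set. [folklore] -/
theorem isDown_lt (w : V) (a : ℕ) : IsDown fun α : PSpace Dset K t => (α w : ℕ) < a :=
  fun _ _ h hβ => lt_of_le_of_lt (Fin.le_def.1 (h w)) hβ

/-- An event *ignores* the coordinate `w` if it is unchanged when only `α w` changes.
[cite: PaturiPudlakSaksZane2005, §3.3 (proof of Lemma 7: "the events Cut_{T_i} and α(v_i) < r are independent")] -/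
def Ignores (w : V) (E : PSpace Dset K t → Prop) : Prop :=
  ∀ ⦃α β : PSpace Dset K t⦄, (∀ u, u ≠ w → α u = β u) → (E α ↔ E β)

/-- "`w` is placed before `a`" ignores every other coordinate. [folklore] -/
theorem ignores_lt {w u : V} (h : u ≠ w) (a : ℕ) :
    Ignores u fun α : PSpace Dset K t => (α w : ℕ) < a := fun α β hαβ => by
  show ((α w : ℕ) < a) ↔ ((β w : ℕ) < a)
  rw [hαβ w h.symm]

/-- The negation of an event ignoring `w` ignores `w`. [folklore] -/
theorem Ignores.not {w : V} {E : PSpace Dset K t → Prop} (hE : Ignores w E) :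
    Ignores w fun α => ¬ E α := fun _ _ h => not_congr (hE h)

/-! ### Probabilities -/

variable [Fintype V]

/-- The probability of an event in `Ω_Γ`: the normalised count. [cite: PaturiPudlakSaksZane2005, §3.3 ("the probability of an event is the Lebesgue measure of the subset"; here: counting measure)] -/
noncomputable def prob (E : PSpace Dset K t → Prop) : ℝ :=
  open scoped Classical in
  ((univ.filter E).card : ℝ) / (Fintype.card (PSpace Dset K t) : ℝ)

/-- `prob` computed with any decidability instance (the definition uses the classical one).
[folklore] -/
theorem prob_eq (E : PSpace Dset K t → Prop) [DecidablePred E] :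
    prob E = ((univ.filter E).card : ℝ) / (Fintype.card (PSpace Dset K t) : ℝ) := by
  have h : (univ.filter E : Finset (PSpace Dset K t)) =
      @Finset.filter _ E (fun a => Classical.propDecidable (E a)) univ := by
    ext; simp
  rw [h]; rfl

/-- Probabilities are nonnegative. [folklore] -/
theorem prob_nonneg (E : PSpace Dset K t → Prop) : 0 ≤ prob E := by
  unfold prob; positivity

/-- Probabilities are at most `1`. [folklore] -/
theorem prob_le_one (E : PSpace Dset K t → Prop) : prob E ≤ 1 := by
  classical
  rw [prob_eq]
  rcases Nat.eq_zero_or_pos (Fintype.card (PSpace Dset K t)) with h | h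
  · simp [h]
  · rw [div_le_one (by exact_mod_cast h)]
    exact_mod_cast (card_filter_le _ _).trans (card_univ (α := PSpace Dset K t)).le

/-- Monotonicity of `prob`. [folklore] -/
theorem prob_mono {E F : PSpace Dset K t → Prop} (h : ∀ α, E α → F α) : prob E ≤ prob F := by
  classical
  rw [prob_eq, prob_eq]
  apply div_le_div_of_nonneg_right _ (by positivity)
  have hs : univ.filter E ⊆ univ.filter F := fun α hα => by
    rw [mem_filter] at hα ⊢
    exact ⟨hα.1, h α hα.2⟩
  exact_mod_cast card_le_card hs

/-- `prob` respects pointwise equivalence of events. [folklore] -/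
theorem prob_congr {E F : PSpace Dset K t → Prop} (h : ∀ α, E α ↔ F α) : prob E = prob F :=
  le_antisymm (prob_mono fun α => (h α).1) (prob_mono fun α => (h α).2)

/-- The space is nonempty as soon as `0 < K` and `0 < t`. [folklore] -/
theorem card_pSpace_pos (hK : 0 < K) (ht : 0 < t) : 0 < Fintype.card (PSpace Dset K t) :=
  Fintype.card_pos_iff.2 ⟨fun w => ⟨0, size_pos Dset hK ht w⟩⟩

/-- The sure event has probability `1` (for a nonempty space). [folklore] -/
theorem prob_true (hK : 0 < K) (ht : 0 < t) : prob (fun _ : PSpace Dset K t => True) = 1 := by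
  classical
  rw [prob_eq]
  rw [filter_true, card_univ, div_self]
  exact_mod_cast (card_pSpace_pos hK ht).ne'

/-- Complement rule. [folklore] -/
theorem prob_not (hK : 0 < K) (ht : 0 < t) (E : PSpace Dset K t → Prop) :
    prob (fun α => ¬ E α) = 1 - prob E := by
  classical
  have hc : (Fintype.card (PSpace Dset K t) : ℝ) ≠ 0 := by
    exact_mod_cast (card_pSpace_pos hK ht).ne'
  have hset : (univ.filter fun α : PSpace Dset K t => ¬ E α) = univ \ univ.filter E := by
    ext α; simp
  have hle : (univ.filter E).card ≤ Fintype.card (PSpace Dset K t) :=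
    (card_filter_le _ _).trans (card_univ (α := PSpace Dset K t)).le
  rw [prob_eq, prob_eq, hset, card_univ_sdiff, Nat.cast_sub hle]
  field_simp

/-! ### Harris' inequality -/

/-- A sum of an indicator over the order dual is a count. [folklore] -/
theorem sum_dual_indicator (P : PSpace Dset K t → Prop) [DecidablePred P] :
    (∑ a : (PSpace Dset K t)ᵒᵈ, (if P (OrderDual.ofDual a) then (1 : ℝ) else 0)) =
      ((univ.filter P).card : ℝ) := by
  rw [Finset.sum_boole]
  rfl

/-- **Harris' inequality** on the conditioned placement space: two down-sets are positively
correlated, `Pr[E ∧ F] ≥ Pr[E] · Pr[F]`. (From Mathlib's FKG inequality `fkg` on the order dual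
of the distributive lattice `Ω_Γ` with the constant weight.)
[cite: PaturiPudlakSaksZane2005, §3.3 (proof of Lemma 7: "Harris' inequality … (i) and (ii) are sufficient")] -/
theorem prob_and_ge_mul {E F : PSpace Dset K t → Prop} (hE : IsDown E) (hF : IsDown F) :
    prob E * prob F ≤ prob fun α => E α ∧ F α := by
  classical
  -- indicator functions on the order dual, where down-sets become up-sets
  set f : (PSpace Dset K t)ᵒᵈ → ℝ := fun a => if E (OrderDual.ofDual a) then 1 else 0 with hf
  set g : (PSpace Dset K t)ᵒᵈ → ℝ := fun a => if F (OrderDual.ofDual a) then 1 else 0 with hg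
  have hf0 : 0 ≤ f := fun a => by rw [hf]; dsimp only; split_ifs <;> norm_num
  have hg0 : 0 ≤ g := fun a => by rw [hg]; dsimp only; split_ifs <;> norm_num
  have hfm : Monotone f := by
    intro a b hab
    rw [hf]; dsimp only
    by_cases hb : E (OrderDual.ofDual b)
    · rw [if_pos hb]; split_ifs <;> norm_num
    · have ha : ¬ E (OrderDual.ofDual a) := fun ha =>
        hb (hE (OrderDual.ofDual_le_ofDual.2 hab) ha)
      rw [if_neg ha, if_neg hb]
  have hgm : Monotone g := by
    intro a b hab
    rw [hg]; dsimp only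
    by_cases hb : F (OrderDual.ofDual b)
    · rw [if_pos hb]; split_ifs <;> norm_num
    · have ha : ¬ F (OrderDual.ofDual a) := fun ha =>
        hb (hF (OrderDual.ofDual_le_ofDual.2 hab) ha)
      rw [if_neg ha, if_neg hb]
  have key := fkg f g (fun _ => (1 : ℝ)) (fun _ => zero_le_one) hf0 hg0 hfm hgm
    (fun _ _ => by norm_num)
  simp only [one_mul, sum_const, card_univ, nsmul_eq_mul, mul_one] at key
  have hfg : ∀ a, f a * g a =
      if (E (OrderDual.ofDual a) ∧ F (OrderDual.ofDual a)) then (1 : ℝ) else 0 := by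
    intro a
    rw [hf, hg]; dsimp only
    by_cases h1 : E (OrderDual.ofDual a) <;> by_cases h2 : F (OrderDual.ofDual a) <;>
      simp [h1, h2]
  simp only [hfg] at key
  rw [hf, hg, sum_dual_indicator E, sum_dual_indicator F,
    sum_dual_indicator (fun α => E α ∧ F α), Fintype.card_orderDual] at key
  -- divide by `|Ω|²`
  rw [prob_eq, prob_eq, prob_eq]
  rcases Nat.eq_zero_or_pos (Fintype.card (PSpace Dset K t)) with h0 | hpos
  · simp [h0]
  · have hc : 0 < (Fintype.card (PSpace Dset K t) : ℝ) := by exact_mod_cast hpos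
    rw [div_mul_div_comm, div_le_div_iff₀ (mul_pos hc hc) hc]
    calc ((univ.filter E).card : ℝ) * ((univ.filter F).card : ℝ) *
          (Fintype.card (PSpace Dset K t))
        ≤ (Fintype.card (PSpace Dset K t) * ((univ.filter fun α => E α ∧ F α).card : ℝ)) *
            (Fintype.card (PSpace Dset K t)) :=
          mul_le_mul_of_nonneg_right key hc.le
      _ = _ := by ring

/-- **Harris' inequality, iterated**: a finite family of down-sets satisfies
`Pr[⋀ E_i] ≥ ∏ Pr[E_i]` ("the well known general case follows by a routine induction").
[cite: PaturiPudlakSaksZane2005, §3.3 (end of proof of Lemma 7)] -/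
theorem prob_forall_ge_prod {ι : Type*} [DecidableEq ι] (s : Finset ι)
    {E : ι → PSpace Dset K t → Prop} (hE : ∀ i ∈ s, IsDown (E i)) (hK : 0 < K) (ht : 0 < t) :
    ∏ i ∈ s, prob (E i) ≤ prob fun α => ∀ i ∈ s, E i α := by
  induction s using Finset.induction_on with
  | empty => simp [prob_true hK ht]
  | insert i s his ih =>
    rw [prod_insert his]
    have hs : IsDown fun α => ∀ j ∈ s, E j α :=
      IsDown.forall s fun j hj => hE j (mem_insert_of_mem hj)
    have hi : IsDown (E i) := hE i (mem_insert_self i s)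
    calc prob (E i) * ∏ j ∈ s, prob (E j)
        ≤ prob (E i) * prob (fun α => ∀ j ∈ s, E j α) :=
          mul_le_mul_of_nonneg_left (ih fun j hj => hE j (mem_insert_of_mem hj)) (prob_nonneg _)
      _ ≤ prob (fun α => E i α ∧ ∀ j ∈ s, E j α) := prob_and_ge_mul hi hs
      _ = prob (fun α => ∀ j ∈ insert i s, E j α) := prob_congr fun α => by simp

/-! ### Independence of a coordinate -/

/-- Fibres of an event ignoring `w` over the values of `α w` all have the same size.
[folklore] -/
theorem card_fiber_eq (w : V) {E : PSpace Dset K t → Prop} [DecidablePred E] (hE : Ignores w E)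
    (x x₀ : Fin (size Dset K t w)) :
    (univ.filter fun α : PSpace Dset K t => α w = x ∧ E α).card =
      (univ.filter fun α : PSpace Dset K t => α w = x₀ ∧ E α).card := by
  refine card_bij' (fun α _ => Function.update α w x₀) (fun α _ => Function.update α w x)
    ?_ ?_ ?_ ?_
  · intro α hα
    simp only [mem_filter, mem_univ, true_and] at hα ⊢
    refine ⟨Function.update_self .., (hE fun u hu => ?_).1 hα.2⟩
    rw [Function.update_of_ne hu]
  · intro α hα
    simp only [mem_filter, mem_univ, true_and] at hα ⊢
    refine ⟨Function.update_self .., (hE fun u hu => ?_).1 hα.2⟩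
    rw [Function.update_of_ne hu]
  · intro α hα
    simp only [mem_filter, mem_univ, true_and] at hα
    rw [Function.update_idem, ← hα.1, Function.update_eq_self]
  · intro α hα
    simp only [mem_filter, mem_univ, true_and] at hα
    rw [Function.update_idem, ← hα.1, Function.update_eq_self]

/-- Counting an event ignoring `w` fibrewise: `#{α | A (α w) ∧ E α} = #A · #(one fibre)`.
[folklore] -/
theorem card_filter_coord_and (w : V) (A : Fin (size Dset K t w) → Prop) [DecidablePred A]
    {E : PSpace Dset K t → Prop} [DecidablePred E] (hE : Ignores w E)
    (x₀ : Fin (size Dset K t w)) :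
    (univ.filter fun α : PSpace Dset K t => A (α w) ∧ E α).card =
      (univ.filter A).card * (univ.filter fun α : PSpace Dset K t => α w = x₀ ∧ E α).card := by
  have hmaps : ((univ.filter fun α : PSpace Dset K t => A (α w) ∧ E α : Finset _) : Set _).MapsTo
      (fun α : PSpace Dset K t => α w) (univ.filter A : Finset _) := by
    intro α hα
    rw [mem_coe, mem_filter] at hα
    exact mem_coe.2 (mem_filter.2 ⟨mem_univ _, hα.2.1⟩)
  rw [card_eq_sum_card_fiberwise hmaps, sum_const_nat]
  intro x hx
  rw [mem_filter] at hx
  rw [card_fiber_eq w hE x₀ x]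
  congr 1
  ext α
  simp only [mem_filter, mem_univ, true_and]
  constructor
  · rintro ⟨⟨-, hEα⟩, h⟩; exact ⟨h, hEα⟩
  · rintro ⟨h, hEα⟩; exact ⟨⟨h ▸ hx.2, hEα⟩, h⟩

/-- **Independence of a coordinate.** For an event `E` ignoring `w` and a condition `A` on the
placement of `w`: `Pr[A(α w) ∧ E] = (#A / size w) · Pr[E]`.
[cite: PaturiPudlakSaksZane2005, §3.3 (proof of Lemma 7, independence step)] -/
theorem prob_coord_and (w : V) (A : Fin (size Dset K t w) → Prop) [DecidablePred A]
    {E : PSpace Dset K t → Prop} (hE : Ignores w E) (hw : 0 < size Dset K t w) :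
    prob (fun α => A (α w) ∧ E α) = ((univ.filter A).card : ℝ) / (size Dset K t w) * prob E := by
  classical
  have x₀ : Fin (size Dset K t w) := ⟨0, hw⟩
  have h1 := card_filter_coord_and w A hE x₀
  have h2 : (univ.filter E).card =
      size Dset K t w * (univ.filter fun α : PSpace Dset K t => α w = x₀ ∧ E α).card := by
    have := card_filter_coord_and w (fun _ => True) hE x₀
    simpa using this
  rw [prob_eq, prob_eq, h1, h2]
  push_cast
  have hs : (size Dset K t w : ℝ) ≠ 0 := by exact_mod_cast hw.ne'
  field_simp

/-- The number of placements of `w` below `a` is `min a (size w)`. [folklore] -/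
theorem card_filter_val_lt (n a : ℕ) :
    (univ.filter fun x : Fin n => (x : ℕ) < a).card = min a n := by
  rw [← card_map Fin.valEmbedding]
  have : (univ.filter fun x : Fin n => (x : ℕ) < a).map Fin.valEmbedding = range (min a n) := by
    ext m
    simp only [mem_map, mem_filter, mem_univ, true_and, Fin.valEmbedding_apply, mem_range,
      lt_min_iff]
    constructor
    · rintro ⟨x, hx, rfl⟩; exact ⟨hx, x.isLt⟩
    · rintro ⟨hma, hmn⟩; exact ⟨⟨m, hmn⟩, hma, rfl⟩
  rw [this, card_range]

/-- The event "`w` is placed before `a`" has probability `min(a, size w)/size w`.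
[cite: PaturiPudlakSaksZane2005, §3.3 (q_i = the probability that α(v_i) ≤ r) and §4.2 (proof of Lemma 13: min{1, (k−1)r/(k−2)})] -/
theorem prob_lt_eq (hK : 0 < K) (ht : 0 < t) (w : V) (a : ℕ) :
    prob (fun α : PSpace Dset K t => (α w : ℕ) < a) =
      ((min a (size Dset K t w) : ℕ) : ℝ) / (size Dset K t w) := by
  classical
  have hw : 0 < size Dset K t w := size_pos Dset hK ht w
  have h := prob_coord_and w (fun x => (x : ℕ) < a) (E := fun _ => True)
    (fun _ _ _ => Iff.rfl) hw
  rw [prob_true hK ht, mul_one, card_filter_val_lt] at h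
  rw [← h]
  exact prob_congr fun α => by simp

/-- **The recursion step of Lemma 7**: for an event `E` ignoring `w`,
`Pr[α w < a ∨ E] = q + (1 - q) · Pr[E]` with `q = min(a, size w) / size w` the probability that
`w` is placed before `a`. [cite: PaturiPudlakSaksZane2005, Lemma 7 (Prob[K_i] = q_i + (1 − q_i) Q_{T_i}(r))] -/
theorem prob_lt_or_eq (hK : 0 < K) (ht : 0 < t) (w : V) (a : ℕ) {E : PSpace Dset K t → Prop}
    (hE : Ignores w E) :
    prob (fun α => (α w : ℕ) < a ∨ E α) =
      ((min a (size Dset K t w) : ℕ) : ℝ) / (size Dset K t w) +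
        (1 - ((min a (size Dset K t w) : ℕ) : ℝ) / (size Dset K t w)) * prob E := by
  classical
  have hw : 0 < size Dset K t w := size_pos Dset hK ht w
  have hs : (size Dset K t w : ℝ) ≠ 0 := by exact_mod_cast hw.ne'
  have hnot : prob (fun α => (α w : ℕ) < a ∨ E α) =
      1 - prob (fun α => ¬ ((α w : ℕ) < a) ∧ ¬ E α) := by
    rw [← prob_not hK ht]
    exact prob_congr fun α => by tauto
  rw [hnot, prob_coord_and w (fun x => ¬ ((x : ℕ) < a)) hE.not hw, prob_not hK ht]
  have hc : ((univ.filter fun x : Fin (size Dset K t w) => ¬ ((x : ℕ) < a)).card : ℝ) =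
      (size Dset K t w : ℝ) - ((min a (size Dset K t w) : ℕ) : ℝ) := by
    have hset : (univ.filter fun x : Fin (size Dset K t w) => ¬ ((x : ℕ) < a)) =
        univ \ univ.filter fun x : Fin (size Dset K t w) => (x : ℕ) < a := by
      ext x; simp
    rw [hset, card_univ_sdiff, Fintype.card_fin, card_filter_val_lt,
      Nat.cast_sub (min_le_right _ _)]
  rw [hc]
  field_simp
  ring

end Literature.Computability.FineGrained.PPSZ
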